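import Literature.Analysis.FluidPDE.PalasekQuantitativeAxisym
import Literature.Analysis.FunctionSpaces.WeakLp
import HarnessLib

/-!
# Ożański–Palasek 2022: double-exponential quantitative regularity of axisymmetric solutions in
# terms of the weak-`L³` norm, and the double-logarithmic blow-up rate of `‖u(t)‖_{L^{3,∞}}`

Topic `Analysis/FluidPDE`. Source: W. S. Ożański, S. Palasek, *Quantitative control of solutions to
the axisymmetric Navier–Stokes equations in terms of the weak `L³` norm*, Ann. PDE 9 (2023) no. 15 =
arXiv:2210.10030 [`OzanskiPalasek2022`]; read in the arXiv version (held text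
`paper:arxiv-2210.10030`), §1.1–1.3 (pp. 4–6: the standing bound (1.2)
`‖u‖_{L^∞([0,T]; L^{3,∞}(ℝ³))} ≤ A` "for some `A ≫ 1`", **Theorem 1.1**, **Corollary 1.2**). One
file for §1 (D-0064). The `L³` predecessor (Palasek 2021, Thm 1, `q = 3`) is the tree's
`palasek2021_axisym_quantitative_ess`, whose conventions are followed to the letter (Tao's class
`IsHkClassicalSolutionOn`, `IsAxisymmetric (u t)` at every time, `palasekDoubleExp C A =
exp exp (A^C)`, velocity bounds `j = 0, 1` only, unit viscosity).

## The printed statements (unit viscosity, no force)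

* **Theorem 1.1** (Main result). "Suppose `u` is a classical axisymmetric solution of (NSE) on
  `[0,T] × ℝ³` obeying [(1.2)]. Then `‖∇ʲu(t)‖_{L^∞_x(ℝ³)} ≤ t^{−(1+j)/2} exp exp(A^{O_j(1)})` for
  all `j ≥ 0`, `t ∈ [0,T]`."
* **Corollary 1.2** (Blow-up rate of the weak-`L³` norm). "If `u` is a classical axisymmetric
  solution of (NSE) that blows up at `T₀`, then
  `limsup_{t→T₀⁻} ‖u(t)‖_{L^{3,∞}(ℝ³)} / (log log (T₀−t)^{−1})^c = +∞`." (§1.3: from Thm 1.1 and the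
  rate `‖u(t)‖_∞ ≥ c/(T₀−t)^{1/2}`; p. 6: Thm 1.1 also yields "the non-existence of nontrivial
  ancient axisymmetric solutions in `L^∞_t L^{3,∞}_x`".)

## Contents

* `ozanskiPalasek2022_axisym_weakL3_quantitative` — Theorem 1.1 (`j = 0, 1`), named fact.
* `ozanskiPalasek2022_axisym_weakL3_blowup_rate` — Corollary 1.2, named fact.
* `ozanskiPalasek2022_axisym_weakL3_quantitative_allDerivs` — Theorem 1.1 for all `j ≥ 0`
  (`iteratedFDeriv`; third proposal of this file).
* (second proposal of this file, proof-only)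
  `ozanskiPalasek2022_axisym_weakL3_quantitative.L3_version` — PROVED: the fact implies the
  `L³`-hypothesis statement of the same shape (Chebyshev: `‖u‖_{L^{3,∞}} ≤ ‖u‖_{L³}`, the tree's
  `FunctionSpaces.eWeakLpPow_le_eLpNorm_rpow`), i.e. Palasek's `q = 3` theorem up to the
  threshold on `A`.

## Transcription notes (never stronger than print)

* *Class.* "Classical solution on `[0,T] × ℝ³`" is rendered, as for
  `palasek2021_axisym_quantitative_ess` and `tao_quantitative_ess`, by Tao's class
  `IsHkClassicalSolutionOn (Icc 0 T) u p` (smooth, all `‖∇ⁿu(t)‖_{L²}` bounded on `[0,T]`; a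
  stronger hypothesis); axisymmetry = `IsAxisymmetric (u t)` for every `t ∈ [0,T]`.
* *The bound (1.2)* at every `t ∈ [0,T]` via the weak-`L³` functional
  `FunctionSpaces.eWeakLpPow (u t) 3 volume ≤ (ofReal A)³` (`‖g‖_{L^{3,∞}} = sup_α α d_g(α)^{1/3}`).
  "`A ≫ 1`" = `A ≥ A₀` for a universal threshold `A₀` (recorded existentially; Palasek's file fixes
  `A ≥ 2` because that paper says so — this one does not).
* *`exp exp(A^{O_j(1)})`, `j = 0, 1`* = `palasekDoubleExp C A` for ONE absolute `C` serving both
  `j = 0` and `j = 1` (take the larger exponent; valid as `A ≥ A₀ ≥ 2` may be assumed). The bound at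
  `t = 0` is vacuous in print (`t^{−1/2} = ∞`) and is recorded for `0 < t ≤ T` only.
* *Cor. 1.2.* "Classical axisymmetric solution that blows up at `T₀`": in Tao's class on every
  `[0,T']`, `T' < T₀`, axisymmetric at all times, and unbounded on `[0,T₀) × ℝ³`. The exponent `c >
  0` of the corollary is universal (existential). `limsup = +∞` is recorded as: for every `K`,
  frequently as `t ↑ T₀`, `‖u(t)‖_{L^{3,∞}} > K (log log (T₀−t)^{−1})^c`, in `ℝ≥0∞` with cubes.
* Not here: the bounds for the vorticity, Cor. 1.3 (mild supercritical
  Type-I-type criterion), §§2–6 and the proofs; the viscosity is `1` as in the source and in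
  `IsHkClassicalSolutionOn`.

## Mathlib / tree search

`lean search 'OzanskiPalasek2022|2210.10030|weakL3_quantitative'`: the key is cited in prose by
`AxisymmetricHeatFlow.lean` (heat flow preserves axisymmetry, for the Palasek programme) and the
barrier `HypodissipativeLerayNonuniqueness`; Theorem 1.1 / Cor. 1.2 were not transcribed
(2026-08-26). Reused: `IsHkClassicalSolutionOn`, `IsAxisymmetric`, `palasekDoubleExp`,
`FunctionSpaces.eWeakLpPow`, `FunctionSpaces.eWeakLpPow_le_eLpNorm_rpow`.

## References

* W. S. Ożański, S. Palasek, Ann. PDE 9 (2023) no. 15 = arXiv:2210.10030: §1.1 p. 4 (Thm 1.1,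
  (1.2)), §1.3 p. 5 (Cor. 1.2). [`OzanskiPalasek2022`]
* S. Palasek, ARMA 242 (2021) = arXiv:2101.08586, Thm 1 — the tree's
  `palasek2021_axisym_quantitative_ess`. [`Palasek2021`]
-/

noncomputable section

open MeasureTheory Set Filter
open _root_.Topology
open scoped ENNReal

namespace Literature.Analysis.FluidPDE

/-- **Ożański–Palasek 2022, Theorem 1.1 (`j = 0, 1`): double-exponential bounds for axisymmetric
classical solutions in terms of the weak-`L³` norm.** There are absolute constants `C > 0` and
`A₀` such that: if `(u,p)` is a classical solution of the unforced unit-viscosity Navier–Stokes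
system on `[0,T] × ℝ³` in Tao's class (`IsHkClassicalSolutionOn`), `u(t)` is axisymmetric for every
`t ∈ [0,T]`, and `‖u(t)‖_{L^{3,∞}} ≤ A` for all `t ∈ [0,T]` (`sup_α α³|{|u(t)| > α}| ≤ A³`) with
`A ≥ A₀`, then for all `0 < t ≤ T` and `x`: `|u(t,x)| ≤ exp exp(A^C) t^{−1/2}` and
`|∇u(t,x)| ≤ exp exp(A^C) t^{−1}`. Printed: "`‖∇ʲu(t)‖_{L^∞} ≤ t^{−(1+j)/2} exp exp(A^{O_j(1)})` for
all `j ≥ 0`" under `‖u‖_{L^∞([0,T];L^{3,∞})} ≤ A`, `A ≫ 1` (here `j = 0, 1`, one exponent `C`,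
threshold `A₀`; "classical" strengthened to Tao's class). [cite: OzanskiPalasek2022, Thm. 1.1 (arXiv:2210.10030 §1.1 p. 4)] -/
def ozanskiPalasek2022_axisym_weakL3_quantitative : Prop :=
  ∃ C A₀ : ℝ, 0 < C ∧ ∀ (T A : ℝ)
      (u : ℝ → EuclideanSpace ℝ (Fin 3) → EuclideanSpace ℝ (Fin 3))
      (p : ℝ → EuclideanSpace ℝ (Fin 3) → ℝ),
      IsHkClassicalSolutionOn (Icc 0 T) u p →
      (∀ t ∈ Icc 0 T, IsAxisymmetric (u t)) →
      (∀ t ∈ Icc 0 T, FunctionSpaces.eWeakLpPow (u t) 3 volume ≤ ENNReal.ofReal A ^ (3 : ℝ)) →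
      A₀ ≤ A →
      ∀ t ∈ Ioc 0 T, ∀ x : EuclideanSpace ℝ (Fin 3),
        ‖u t x‖ ≤ palasekDoubleExp C A * t ^ (-(1 / 2 : ℝ)) ∧
        ‖fderiv ℝ (u t) x‖ ≤ palasekDoubleExp C A * t ^ (-(1 : ℝ))

/-- **Ożański–Palasek 2022, Corollary 1.2: double-logarithmic blow-up rate of the weak-`L³`
norm for axisymmetric solutions.** There is a universal `c > 0` such that: if `(u,p)` is a classical
solution of the unforced unit-viscosity Navier–Stokes system on `[0,T₀) × ℝ³` — in Tao's class on
every `[0,T']`, `T' < T₀` — with `u(t)` axisymmetric for all `t ∈ [0,T₀)`, which blows up at `T₀`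
(`u` is unbounded on `[0,T₀) × ℝ³`), then
`limsup_{t↑T₀} ‖u(t)‖_{L^{3,∞}} / (log log (T₀−t)^{−1})^c = +∞`: for every `K`, frequently as
`t ↑ T₀`, `sup_α α³|{|u(t)| > α}| > (K (log log (T₀−t)^{−1})^c)³`. [cite: OzanskiPalasek2022, Cor. 1.2 (arXiv:2210.10030 §1.3 p. 5)] -/
def ozanskiPalasek2022_axisym_weakL3_blowup_rate : Prop :=
  ∃ c : ℝ, 0 < c ∧ ∀ (T₀ : ℝ), 0 < T₀ →
    ∀ (u : ℝ → EuclideanSpace ℝ (Fin 3) → EuclideanSpace ℝ (Fin 3))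
      (p : ℝ → EuclideanSpace ℝ (Fin 3) → ℝ),
      (∀ T' ∈ Ioo 0 T₀, IsHkClassicalSolutionOn (Icc 0 T') u p) →
      (∀ t ∈ Ico 0 T₀, IsAxisymmetric (u t)) →
      (∀ B : ℝ, ∃ t ∈ Ico 0 T₀, ∃ x : EuclideanSpace ℝ (Fin 3), B < ‖u t x‖) →
      ∀ K : ℝ, ∃ᶠ t in 𝓝[<] T₀,
        ENNReal.ofReal (K * Real.log (Real.log (T₀ - t)⁻¹) ^ c) ^ (3 : ℝ) <
          FunctionSpaces.eWeakLpPow (u t) 3 volume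

/-- **The weak-`L³` theorem contains the `L³` one** (Chebyshev, `‖g‖_{L^{3,∞}} ≤ ‖g‖_{L³}`): from
`ozanskiPalasek2022_axisym_weakL3_quantitative` one gets the statement of Palasek 2021, Thm 1
(`q = 3`, axisymmetric, `j = 0, 1`) with the threshold `A ≥ A₀` in place of `A ≥ 2`. [cite: OzanskiPalasek2022, Thm. 1.1 and §1 ("improve on those in [Palasek]")] -/
theorem ozanskiPalasek2022_axisym_weakL3_quantitative.L3_version
    (h : ozanskiPalasek2022_axisym_weakL3_quantitative) :
    ∃ C A₀ : ℝ, 0 < C ∧ ∀ (T A : ℝ)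
      (u : ℝ → EuclideanSpace ℝ (Fin 3) → EuclideanSpace ℝ (Fin 3))
      (p : ℝ → EuclideanSpace ℝ (Fin 3) → ℝ),
      IsHkClassicalSolutionOn (Icc 0 T) u p →
      (∀ t ∈ Icc 0 T, IsAxisymmetric (u t)) →
      (∀ t ∈ Icc 0 T, eLpNorm (u t) 3 volume ≤ ENNReal.ofReal A) →
      A₀ ≤ A →
      ∀ t ∈ Ioc 0 T, ∀ x : EuclideanSpace ℝ (Fin 3),
        ‖u t x‖ ≤ palasekDoubleExp C A * t ^ (-(1 / 2 : ℝ)) ∧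
        ‖fderiv ℝ (u t) x‖ ≤ palasekDoubleExp C A * t ^ (-(1 : ℝ)) := by
  obtain ⟨C, A₀, hC, h⟩ := h
  refine ⟨C, A₀, hC, fun T A u p hu hax h3 hA => h T A u p hu hax (fun t ht => ?_) hA⟩
  have hmeas : AEStronglyMeasurable (u t) volume :=
    ((hu.isClassicalNSSolutionOn.contDiff_velocity ht).continuous).aestronglyMeasurable
  calc FunctionSpaces.eWeakLpPow (u t) 3 volume
      ≤ eLpNorm (u t) 3 volume ^ (3 : ℝ≥0∞).toReal :=
        FunctionSpaces.eWeakLpPow_le_eLpNorm_rpow (by norm_num) (by norm_num) hmeas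
    _ = eLpNorm (u t) 3 volume ^ (3 : ℝ) := by norm_num
    _ ≤ ENNReal.ofReal A ^ (3 : ℝ) := by
        gcongr
        exact h3 t ht

/-- **Ożański–Palasek 2022, Theorem 1.1, all orders `j ≥ 0`.** For every `j` there are constants
`C_j > 0` and `A₀` such that: if `(u,p)` is a classical solution of the unforced unit-viscosity
Navier–Stokes system on `[0,T] × ℝ³` in Tao's class, `u(t)` axisymmetric for every `t ∈ [0,T]`,
and `‖u(t)‖_{L^{3,∞}} ≤ A` for all `t ∈ [0,T]` with `A ≥ A₀`, then for all `0 < t ≤ T` and `x`,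
`|∇ʲu(t,x)| ≤ exp exp(A^{C_j}) t^{−(1+j)/2}` (`∇ʲu(t)` = `iteratedFDeriv ℝ j (u t)`, operator
norm). Printed: "`‖∇ʲu(t)‖_{L^∞_x(ℝ³)} ≤ t^{−(1+j)/2} exp exp(A^{O_j(1)})` for all `j ≥ 0`,
`t ∈ [0,T]`" under (1.2), `A ≫ 1` (here the threshold may depend on `j` as well — weaker).
Complements `ozanskiPalasek2022_axisym_weakL3_quantitative` (`j = 0, 1` with `fderiv`), added at a
reviewer's request (third proposal of this file). [cite: OzanskiPalasek2022, Thm. 1.1 (arXiv:2210.10030 §1.1 p. 4)] -/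
def ozanskiPalasek2022_axisym_weakL3_quantitative_allDerivs : Prop :=
  ∀ j : ℕ, ∃ C A₀ : ℝ, 0 < C ∧ ∀ (T A : ℝ)
      (u : ℝ → EuclideanSpace ℝ (Fin 3) → EuclideanSpace ℝ (Fin 3))
      (p : ℝ → EuclideanSpace ℝ (Fin 3) → ℝ),
      IsHkClassicalSolutionOn (Icc 0 T) u p →
      (∀ t ∈ Icc 0 T, IsAxisymmetric (u t)) →
      (∀ t ∈ Icc 0 T, FunctionSpaces.eWeakLpPow (u t) 3 volume ≤ ENNReal.ofReal A ^ (3 : ℝ)) →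
      A₀ ≤ A →
      ∀ t ∈ Ioc 0 T, ∀ x : EuclideanSpace ℝ (Fin 3),
        ‖iteratedFDeriv ℝ j (u t) x‖ ≤ palasekDoubleExp C A * t ^ (-((1 + (j : ℝ)) / 2))

end Literature.Analysis.FluidPDE

end
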